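import Summits.ResolutionOfSingularities.ResolutionOfSingularities.Theses.Valuative
import Literature.RingTheory.KrullDimension.AffineCatenary

/-!
# `Valuative.LuAlphaPTorsor`, toroidal exit — helper file 1: polynomial presentations

Route `ResolutionOfSingularities/Valuative`, crux `LuAlphaPTorsor` (stmt-0641), line
`pfaff-line-log-final-forms`, stub `stub_toroidalExit`. Pure commutative algebra used by the
regularity engine of the toroidal exit:

* `spanFinrank_maximalIdeal_le_card_add` — for a Noetherian local ring `S` and a finite set
  `Y ⊆ 𝔪`, `μ(𝔪_S) ≤ #Y + μ(𝔪_{S/(Y)})`;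
* `spanFinrank_maximalIdeal_le_height` — if a Noetherian local ring `B` is "essentially a
  quotient" of a polynomial ring `κ[X_σ]` over a field (`φ : κ[X_σ] → B` with every element of
  `B` of the form `φ f / φ g`), then `μ(𝔪_B) ≤ ht(φ⁻¹ 𝔪_B)` (the localisation of `κ[X_σ]` at the
  prime `φ⁻¹ 𝔪_B` is a regular local ring surjecting onto `B`);
* `height_comap_subst` — specialising the variables `X_i ↦ c_i` (`i ∈ I₀`) raises heights of
  primes by exactly `#I₀` (dimension formula for affine domains, tree `AffineCatenary.lean`);
* `spanFinrank_add_card_le_height'` — hence `μ(𝔪_B) + #I₀ ≤ ht(φ⁻¹ 𝔪_B)` as soon as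
  `φ (X_i) = φ (c_i)` for `i ∈ I₀`; `spanFinrank_add_card_le_height` is its universe-monomorphic
  form (the registered sub-goal of this helper file).
-/

noncomputable section

-- `Summit.<S>.<S>.…` duplicates the summit name by design (D-0017, single-problem summit).
set_option linter.dupNamespace false

open IsLocalRing MvPolynomial

namespace Summit.ResolutionOfSingularities.ResolutionOfSingularities.Theorems.PfaffLine

/-! ## §1 Generators of the maximal ideal modulo a finite set -/

section Quotient

variable {S : Type*} [CommRing S] [IsLocalRing S]

/-- The image of the maximal ideal under a surjection onto a nontrivial ring is the maximal
ideal of the target (which is local). -/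
theorem map_maximalIdeal_of_surjective {T : Type*} [CommRing T] [IsLocalRing T] (f : S →+* T)
    (hf : Function.Surjective f) (hle : (maximalIdeal S).map f ≤ maximalIdeal T) :
    (maximalIdeal S).map f = maximalIdeal T := by
  rcases Ideal.map_eq_top_or_isMaximal_of_surjective f hf
    (H := IsLocalRing.maximalIdeal.isMaximal S) with h | h
  · exact absurd (top_le_iff.mp (h ▸ hle)) (IsLocalRing.maximalIdeal.isMaximal T).ne_top
  · exact IsLocalRing.eq_maximalIdeal h

/-- If `f : S → T` is a surjection of local rings mapping `𝔪_S` into `𝔪_T`, the minimal number of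
generators of `𝔪_T` is at most that of `𝔪_S`. -/
theorem spanFinrank_maximalIdeal_le_of_surjective [IsNoetherianRing S] {T : Type*} [CommRing T]
    [IsLocalRing T] (f : S →+* T) (hf : Function.Surjective f)
    (hle : (maximalIdeal S).map f ≤ maximalIdeal T) :
    (maximalIdeal T).spanFinrank ≤ (maximalIdeal S).spanFinrank := by
  classical
  obtain ⟨G, hGcard, hGspan⟩ := Submodule.FG.exists_span_finset_card_eq_spanFinrank
    (IsNoetherian.noetherian (maximalIdeal S))
  have hmap := map_maximalIdeal_of_surjective f hf hle
  have hT : maximalIdeal T = Ideal.span ((G.image f : Finset T) : Set T) := by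
    rw [← hmap, show maximalIdeal S = Ideal.span (G : Set S) from hGspan.symm, Ideal.map_span,
      Finset.coe_image]
  rw [hT, ← hGcard]
  refine (Submodule.spanFinrank_span_le_ncard_of_finite (Finset.finite_toSet _)).trans ?_
  rw [Set.ncard_coe_finset]
  exact Finset.card_image_le

/-- **Generators modulo a finite set.** For a Noetherian local ring `S` and an ideal
`I = (Y)` generated by a finite set `Y ⊆ 𝔪_S` (so that `S/I` is local):
`μ(𝔪_S) ≤ #Y + μ(𝔪_{S/I})` — lift generators of the maximal ideal of the quotient and add `Y`. -/
theorem spanFinrank_maximalIdeal_le_card_add [IsNoetherianRing S] (I : Ideal S)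
    [IsLocalRing (S ⧸ I)] (Y : Finset S) (hI : Ideal.span (Y : Set S) = I)
    (hY : (Y : Set S) ⊆ maximalIdeal S) :
    (maximalIdeal S).spanFinrank ≤ Y.card + (maximalIdeal (S ⧸ I)).spanFinrank := by
  classical
  let π : S →+* S ⧸ I := Ideal.Quotient.mk I
  have hπ : Function.Surjective π := Ideal.Quotient.mk_surjective
  obtain ⟨G, hGcard, hGspan⟩ := Submodule.FG.exists_span_finset_card_eq_spanFinrank
    (IsNoetherian.noetherian (maximalIdeal (S ⧸ I)))
  have hπ' := hπ
  choose lift hlift using hπ'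
  have hIle : I ≤ maximalIdeal S := by rwa [← hI, Ideal.span_le]
  have hker : RingHom.ker π = I := Ideal.mk_ker
  -- `𝔪_S` maps onto the maximal ideal of `S / I`
  have hmap : (maximalIdeal S).map π = maximalIdeal (S ⧸ I) := by
    rcases Ideal.map_eq_top_or_isMaximal_of_surjective π hπ
      (H := IsLocalRing.maximalIdeal.isMaximal S) with h | h
    · exfalso
      have := congrArg (Ideal.comap π) h
      rw [Ideal.comap_map_of_surjective π hπ, Ideal.comap_top, ← RingHom.ker_eq_comap_bot,
        hker, sup_eq_left.mpr hIle] at this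
      exact (IsLocalRing.maximalIdeal.isMaximal S).ne_top this
    · exact IsLocalRing.eq_maximalIdeal h
  -- `𝔪_S` is generated by `Y` and lifts of the generators `G`
  let gens : Finset S := Y ∪ G.image lift
  have hgens : maximalIdeal S = Ideal.span (gens : Set S) := by
    apply le_antisymm
    · intro x hx
      have h1 : π x ∈ (Ideal.span ((G.image lift : Finset S) : Set S)).map π := by
        rw [Ideal.map_span, Finset.coe_image, ← Set.image_comp]
        have hcomp : (π ∘ lift) '' (G : Set (S ⧸ I)) = G := by
          rw [show (π : S → S ⧸ I) ∘ lift = id from funext hlift, Set.image_id]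
        rw [hcomp, show Ideal.span (G : Set (S ⧸ I)) = maximalIdeal _ from hGspan, ← hmap]
        exact Ideal.mem_map_of_mem _ hx
      rw [← Ideal.mem_comap, Ideal.comap_map_of_surjective π hπ, ← RingHom.ker_eq_comap_bot,
        Ideal.mk_ker] at h1
      have h2 : Ideal.span ((G.image lift : Finset S) : Set S) ⊔ I ≤
          Ideal.span (gens : Set S) := by
        refine sup_le (Ideal.span_mono ?_) ?_
        · intro z hz
          simp only [gens, Finset.coe_union]
          exact Or.inr hz
        · rw [← hI]
          refine Ideal.span_mono ?_
          intro z hz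
          simp only [gens, Finset.coe_union]
          exact Or.inl hz
      exact h2 h1
    · rw [Ideal.span_le]
      intro z hz
      simp only [gens, Finset.coe_union, Finset.coe_image, Set.mem_union, Set.mem_image,
        Finset.mem_coe] at hz
      rcases hz with hz | ⟨g, hg, rfl⟩
      · exact hY hz
      · rw [SetLike.mem_coe, mem_maximalIdeal, mem_nonunits_iff]
        intro hu
        have hg' : g ∈ maximalIdeal _ := hGspan ▸ Submodule.subset_span hg
        rw [mem_maximalIdeal, mem_nonunits_iff] at hg'
        apply hg'
        rw [← hlift g]
        exact hu.map π
  rw [hgens, ← hGcard]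
  refine (Submodule.spanFinrank_span_le_ncard_of_finite (Finset.finite_toSet gens)).trans ?_
  rw [Set.ncard_coe_finset]
  exact (Finset.card_union_le _ _).trans (Nat.add_le_add_left Finset.card_image_le _)

end Quotient

/-! ## §2 Local rings essentially of finite presentation over a field -/

section Field

variable {κ : Type*} [Field κ] {σ : Type*} [Fintype σ]
variable {B : Type*} [CommRing B] [IsLocalRing B]

/-- **Embedding bound.** If `φ : κ[X_σ] → B` (`κ` a field, `B` Noetherian local) is
*essentially surjective* — every `b ∈ B` is `φ f / φ g` with `φ g` a unit — then
`μ(𝔪_B) ≤ ht(φ⁻¹ 𝔪_B)`: the localisation of the regular ring `κ[X_σ]` at the prime `φ⁻¹ 𝔪_B` is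
a regular local ring of that dimension surjecting onto `B`, maximal ideal onto maximal ideal. -/
theorem spanFinrank_maximalIdeal_le_height (φ : MvPolynomial σ κ →+* B)
    (hφ : ∀ b : B, ∃ f g : MvPolynomial σ κ, IsUnit (φ g) ∧ φ f = b * φ g) :
    (((maximalIdeal B).spanFinrank : ℕ) : ℕ∞) ≤ ((maximalIdeal B).comap φ).height := by
  classical
  set Q : Ideal (MvPolynomial σ κ) := (maximalIdeal B).comap φ with hQ
  haveI hQp : Q.IsPrime := Ideal.comap_isPrime φ (maximalIdeal B)
  let G := Localization.AtPrime Q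
  haveI : IsRegularLocalRing G := inferInstance
  have hunit : ∀ s : Q.primeCompl, IsUnit (φ s) := fun s => by
    by_contra h
    exact s.2 (show (s : MvPolynomial σ κ) ∈ Q from h)
  let ψ : G →+* B := IsLocalization.lift hunit
  have hψa : ∀ f, ψ (algebraMap _ G f) = φ f := fun f => IsLocalization.lift_eq hunit f
  have hψ : Function.Surjective ψ := by
    intro b
    obtain ⟨f, g, hg, hfg⟩ := hφ b
    have hgQ : g ∈ Q.primeCompl := fun h => h hg
    refine ⟨IsLocalization.mk' G f ⟨g, hgQ⟩, ?_⟩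
    rw [IsLocalization.lift_mk'_spec]
    simpa [mul_comm] using hfg
  have hle : (maximalIdeal G).map ψ ≤ maximalIdeal B := by
    rw [← Localization.AtPrime.map_eq_maximalIdeal, Ideal.map_map, IsLocalization.lift_comp,
      hQ]
    exact Ideal.map_comap_le
  have h1 := spanFinrank_maximalIdeal_le_of_surjective ψ hψ hle
  have h2 := IsRegularLocalRing.spanFinrank_maximalIdeal (R := G)
  rw [IsLocalization.AtPrime.ringKrullDim_eq_height Q G] at h2
  have h3 : (((maximalIdeal G).spanFinrank : ℕ) : ℕ∞) = Q.height := by exact_mod_cast h2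
  rw [← h3]
  exact_mod_cast h1

variable [DecidableEq σ]

/-- The specialisation `X_i ↦ c_i` (`i ∈ I₀`), `X_i ↦ X_i` (`i ∉ I₀`) from `κ[X_σ]` onto the
polynomial ring in the remaining variables. -/
def subst (I₀ : Finset σ) (c : σ → κ) :
    MvPolynomial σ κ →ₐ[κ] MvPolynomial {i // i ∉ I₀} κ :=
  MvPolynomial.aeval fun i => if h : i ∈ I₀ then C (c i) else X ⟨i, h⟩

omit [Fintype σ] in
/-- `subst` is a retraction of the inclusion of the polynomial ring in the remaining
variables; in particular it is surjective. -/
theorem subst_rename (I₀ : Finset σ) (c : σ → κ) (q : MvPolynomial {i // i ∉ I₀} κ) :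
    subst I₀ c (rename Subtype.val q) = q := by
  have : (subst I₀ c).comp (rename Subtype.val) = AlgHom.id κ _ := by
    refine MvPolynomial.algHom_ext fun i => ?_
    simp [subst, dif_neg i.2]
  exact congrArg (fun f => f q) this

omit [Fintype σ] in
/-- `subst` is surjective. -/
theorem subst_surjective (I₀ : Finset σ) (c : σ → κ) : Function.Surjective (subst I₀ c) :=
  fun q => ⟨rename Subtype.val q, subst_rename I₀ c q⟩

/-- **Heights under specialisation of variables**: for a prime `P` of `κ[X_i : i ∉ I₀]`, the
prime `subst⁻¹ P` of `κ[X_σ]` has height `ht P + #I₀` (the two quotients agree, and affine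
domains satisfy `dim A/P + ht P = dim A`, tree `ringKrullDim_quotient_add_height`). -/
theorem height_comap_subst (I₀ : Finset σ) (c : σ → κ) (P : Ideal (MvPolynomial {i // i ∉ I₀} κ))
    [P.IsPrime] :
    (P.comap (subst I₀ c)).height = P.height + I₀.card := by
  set s := subst I₀ c with hs
  set Q : Ideal (MvPolynomial σ κ) := P.comap s
  haveI : Q.IsPrime := Ideal.comap_isPrime s P
  -- the two quotients are isomorphic
  let g : MvPolynomial σ κ →+* MvPolynomial {i // i ∉ I₀} κ ⧸ P :=
    (Ideal.Quotient.mk P).comp s.toRingHom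
  have hg : Function.Surjective g :=
    Ideal.Quotient.mk_surjective.comp (subst_surjective I₀ c)
  have hker : RingHom.ker g = Q := by
    rw [← RingHom.comap_ker, Ideal.mk_ker]
    rfl
  let e : MvPolynomial σ κ ⧸ Q ≃+* MvPolynomial {i // i ∉ I₀} κ ⧸ P :=
    (Ideal.quotEquivOfEq hker.symm).trans (RingHom.quotientKerEquivOfSurjective hg)
  have hdimQ := Literature.RingTheory.KrullDimension.ringKrullDim_quotient_add_height κ Q
  have hdimP := Literature.RingTheory.KrullDimension.ringKrullDim_quotient_add_height κ P
  rw [ringKrullDim_eq_of_ringEquiv e] at hdimQ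
  rw [MvPolynomial.ringKrullDim_of_isNoetherianRing, ringKrullDim_eq_zero_of_field, zero_add,
    Nat.card_eq_fintype_card] at hdimQ hdimP
  obtain ⟨n₀, hn₀, -⟩ := Literature.RingTheory.KrullDimension.exists_ringKrullDim_eq_and_trdeg_eq
    κ (MvPolynomial {i // i ∉ I₀} κ ⧸ P)
  rw [hn₀] at hdimQ hdimP
  have hτ : Fintype.card {i // i ∉ I₀} + I₀.card = Fintype.card σ := by
    have := Fintype.card_subtype_compl (fun i => i ∈ I₀)
    rw [Fintype.card_coe] at this
    have hle : I₀.card ≤ Fintype.card σ := I₀.card_le_univ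
    omega
  -- heights are finite
  have hQfin : Q.height ≠ ⊤ := Ideal.height_ne_top_of_isPrime
  have hPfin : P.height ≠ ⊤ := Ideal.height_ne_top_of_isPrime
  obtain ⟨a, ha⟩ := ENat.ne_top_iff_exists.mp hQfin
  obtain ⟨b, hb⟩ := ENat.ne_top_iff_exists.mp hPfin
  rw [← ha] at hdimQ ⊢
  rw [← hb] at hdimP ⊢
  have h1 : n₀ + a = Fintype.card σ := by exact_mod_cast hdimQ
  have h2 : n₀ + b = Fintype.card {i // i ∉ I₀} := by exact_mod_cast hdimP
  have : a = b + I₀.card := by omega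
  rw [this]
  rfl

/-- **Embedding bound with specialised variables.** In the situation of
`spanFinrank_maximalIdeal_le_height`, if moreover `φ (X_i) = φ (c_i)` for the indices `i ∈ I₀`,
then `μ(𝔪_B) + #I₀ ≤ ht(φ⁻¹ 𝔪_B)` (factor `φ` through the specialisation `X_i ↦ c_i`). -/
theorem spanFinrank_add_card_le_height' (φ : MvPolynomial σ κ →+* B)
    (hφ : ∀ b : B, ∃ f g : MvPolynomial σ κ, IsUnit (φ g) ∧ φ f = b * φ g)
    (I₀ : Finset σ) (c : σ → κ) (hc : ∀ i ∈ I₀, φ (X i) = φ (C (c i))) :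
    (((maximalIdeal B).spanFinrank : ℕ) : ℕ∞) + I₀.card ≤ ((maximalIdeal B).comap φ).height := by
  let φ' : MvPolynomial {i // i ∉ I₀} κ →+* B :=
    φ.comp (rename (Subtype.val : {i // i ∉ I₀} → σ) : _ →ₐ[κ] MvPolynomial σ κ).toRingHom
  have hfac : φ = φ'.comp (subst I₀ c).toRingHom := by
    refine MvPolynomial.ringHom_ext (fun a => ?_) (fun i => ?_)
    · simp [φ']
    · by_cases hi : i ∈ I₀
      · simp [φ', subst, dif_pos hi, hc i hi]
      · simp [φ', subst, dif_neg hi]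
  have hφ' : ∀ b : B, ∃ f g, IsUnit (φ' g) ∧ φ' f = b * φ' g := by
    intro b
    obtain ⟨f, g, hg, hfg⟩ := hφ b
    refine ⟨subst I₀ c f, subst I₀ c g, ?_, ?_⟩
    · have : φ' (subst I₀ c g) = φ g := by rw [hfac]; rfl
      rwa [this]
    · have h1 : φ' (subst I₀ c f) = φ f := by rw [hfac]; rfl
      have h2 : φ' (subst I₀ c g) = φ g := by rw [hfac]; rfl
      rw [h1, h2, hfg]
  have h := spanFinrank_maximalIdeal_le_height φ' hφ'
  haveI : ((maximalIdeal B).comap φ').IsPrime := Ideal.comap_isPrime φ' _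
  have hQ : (maximalIdeal B).comap φ = ((maximalIdeal B).comap φ').comap (subst I₀ c) := by
    conv_lhs => rw [hfac]
    rw [← Ideal.comap_comap]
    rfl
  rw [hQ, height_comap_subst I₀ c]
  exact add_le_add h le_rfl

end Field

/-- **Embedding bound with specialised variables** (registered sub-goal of this helper file; the
universe-monomorphic form of `spanFinrank_add_card_le_height'`): for an essentially surjective
`φ : κ[X_σ] → B` onto a local ring with `φ (X_i) = φ (c_i)` for `i ∈ I₀`,
`μ(𝔪_B) + #I₀ ≤ ht(φ⁻¹ 𝔪_B)`. -/
theorem spanFinrank_add_card_le_height : ∀ {κ : Type} [Field κ] {σ : Type} [Fintype σ] [DecidableEq σ] {B : Type} [CommRing B] [IsLocalRing B] (φ : MvPolynomial σ κ →+* B), (∀ b : B, ∃ f g : MvPolynomial σ κ, IsUnit (φ g) ∧ φ f = b * φ g) → ∀ (I₀ : Finset σ) (c : σ → κ), (∀ i ∈ I₀, φ (MvPolynomial.X i) = φ (MvPolynomial.C (c i))) → (((IsLocalRing.maximalIdeal B).spanFinrank : ℕ) : ℕ∞) + (I₀.card : ℕ∞) ≤ ((IsLocalRing.maximalIdeal B).comap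 φ).height := by
  intro κ _ σ _ _ B _ _ φ hφ I₀ c hc
  exact spanFinrank_add_card_le_height' φ hφ I₀ c hc

end Summit.ResolutionOfSingularities.ResolutionOfSingularities.Theorems.PfaffLine

end
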